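import Mathlib
import Literature.MathematicalPhysics.QuantumFieldTheory.StrongCouplingTorusSystem
import Literature.MathematicalPhysics.QuantumLattice.MagneticHubbardTorusTrivialField

/-!
# LatticeQCDFlow / Scaling — plaquette geometry on the discrete torus of side `≥ 3`:
# two distinct genuine plaquettes share at most one bond

HONEST FRAMING: exact (Metropolis-corrected) sampling algorithms for lattice gauge theory;
figures of merit are autocorrelation/cost numbers at stated couplings and volumes; no
continuum-physics claim.

Venture `LatticeQCDFlow` (cell pub-lqcd), topic `Scaling`, FANOUT row 30 (lean-1) — OUR WORK, the
combinatorial input of the leading-coefficient identity (LC) of theory2 item 120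
(HOME/lean/theory2/LANDING.md §32): on the torus `(ℤ/L)^d` with `L ≥ 3` the four bonds
`(x,k), (x+e_k,l), (x+e_l,k), (x,l)` of a genuine plaquette label `(x,k,l)` (`k < l`,
`StrongCouplingTorusSystem.TPlaq.tbonds`) are pairwise distinct, and TWO DISTINCT GENUINE LABELS
SHARE AT MOST ONE BOND (`eq_of_two_mem_tbonds`; false at `L = 2`, where the plaquettes at `x` and
`x + e_l` of one plane share both their `k`-bonds).  Consequences used by the moment computation:
a genuine label other than `q` misses a bond of `q` outside any prescribed bond
(`two_le_card_tbonds_sdiff`), and the unit vectors `e_k` of `(ℤ/L)^d` satisfy `e_k ≠ 0`,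
`e_k + e_l ≠ 0`, `e_k = e_l → k = l` (the `ℤ/L` facts `1 ≠ 0`, `1 + 1 ≠ 0` are the tree's
`QuantumLattice.zmod_one_ne_zero_of_two_le` / `zmod_one_add_one_ne_zero_of_three_le`).
Elementary; nothing is cited as a fact; no `def`, no `sorry`.
-/

namespace Summit.Ventures.LatticeQCDFlow.Theory2.Lattice.TorusGeom

open Literature.MathematicalPhysics.QuantumFieldTheory
open Literature.MathematicalPhysics.QuantumLattice (zmod_one_ne_zero_of_two_le
  zmod_one_add_one_ne_zero_of_three_le)

variable {d L : ℕ}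

/-! ## §1. Unit vectors of `(ℤ/L)^d`, `L ≥ 3` -/

/-- `e_k ≠ 0`. [folklore] -/
theorem single_ne_zero (hL : 2 ≤ L) (k : Fin d) : (Pi.single k (1 : ZMod L) : Site d L) ≠ 0 := by
  intro h
  have := congr_fun h k
  simp only [Pi.single_eq_same, Pi.zero_apply] at this
  exact zmod_one_ne_zero_of_two_le hL this

/-- `e_k = e_l → k = l`. [folklore] -/
theorem single_inj (hL : 2 ≤ L) {k l : Fin d}
    (h : (Pi.single k (1 : ZMod L) : Site d L) = Pi.single l 1) : k = l := by
  by_contra hkl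
  have := congr_fun h k
  rw [Pi.single_eq_same, Pi.single_eq_of_ne hkl] at this
  exact zmod_one_ne_zero_of_two_le hL this

/-- `e_k + e_l ≠ 0` (for `k = l` this is `2 e_k ≠ 0`, which needs `L ≥ 3`). [folklore] -/
theorem single_add_single_ne_zero (hL : 3 ≤ L) (k l : Fin d) :
    (Pi.single k (1 : ZMod L) : Site d L) + Pi.single l 1 ≠ 0 := by
  intro h
  have := congr_fun h k
  simp only [Pi.add_apply, Pi.single_eq_same, Pi.zero_apply] at this
  by_cases hkl : l = k
  · subst hkl
    rw [Pi.single_eq_same] at this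
    exact zmod_one_add_one_ne_zero_of_three_le hL this
  · rw [Pi.single_eq_of_ne (Ne.symm hkl) , add_zero] at this
    exact zmod_one_ne_zero_of_two_le (by omega) this

/-- `x + e_k ≠ x`. [folklore] -/
theorem add_single_ne_self (hL : 2 ≤ L) (x : Site d L) (k : Fin d) : x + Pi.single k 1 ≠ x := by
  intro h
  exact single_ne_zero hL k (add_eq_left.1 h)

/-- `x + e_k + e_l ≠ x` (`L ≥ 3`). [folklore] -/
theorem add_single_add_single_ne_self (hL : 3 ≤ L) (x : Site d L) (k l : Fin d) :
    x + Pi.single k 1 + Pi.single l 1 ≠ x := by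
  intro h
  rw [add_assoc] at h
  exact single_add_single_ne_zero hL k l (add_eq_left.1 h)

/-- `x + e_k = x + e_l → k = l`. [folklore] -/
theorem eq_of_add_single_eq (hL : 2 ≤ L) {x : Site d L} {k l : Fin d}
    (h : x + Pi.single k (1 : ZMod L) = x + Pi.single l 1) : k = l :=
  single_inj hL (add_left_cancel h)

/-! ## §2. The bonds of a genuine plaquette label -/

/-- Membership in the bond set of a label. [folklore] -/
theorem mem_tbonds_iff {x : Site d L} {k l : Fin d} {b : Edge d L} :
    b ∈ TPlaq.tbonds ((x, k, l) : TPlaq d L) ↔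
      b = (x, k) ∨ b = (x + Pi.single k 1, l) ∨ b = (x + Pi.single l 1, k) ∨ b = (x, l) := by
  simp [TPlaq.tbonds, Site.shift]

/-- The direction of a bond of `(x,k,l)` is `k` or `l`. [folklore] -/
theorem dir_of_mem_tbonds {x : Site d L} {k l : Fin d} {s : Site d L} {m : Fin d}
    (h : ((s, m) : Edge d L) ∈ TPlaq.tbonds ((x, k, l) : TPlaq d L)) : m = k ∨ m = l := by
  rw [mem_tbonds_iff] at h
  rcases h with h | h | h | h <;> simp only [Prod.mk.injEq] at h
  · exact Or.inl h.2
  · exact Or.inr h.2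
  · exact Or.inl h.2
  · exact Or.inr h.2

/-- The base points of the two `k`-bonds of `(x,k,l)`, `k ≠ l`, are `x` and `x + e_l`. [folklore] -/
theorem site_of_mem_tbonds_fst {x : Site d L} {k l : Fin d} (hkl : k ≠ l) {s : Site d L}
    (h : ((s, k) : Edge d L) ∈ TPlaq.tbonds ((x, k, l) : TPlaq d L)) :
    s = x ∨ s = x + Pi.single l 1 := by
  rw [mem_tbonds_iff] at h
  rcases h with h | h | h | h <;> simp only [Prod.mk.injEq] at h
  · exact Or.inl h.1
  · exact absurd h.2 hkl
  · exact Or.inr h.1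
  · exact absurd h.2 hkl

/-- The base points of the two `l`-bonds of `(x,k,l)`, `k ≠ l`, are `x + e_k` and `x`. [folklore] -/
theorem site_of_mem_tbonds_snd {x : Site d L} {k l : Fin d} (hkl : k ≠ l) {s : Site d L}
    (h : ((s, l) : Edge d L) ∈ TPlaq.tbonds ((x, k, l) : TPlaq d L)) :
    s = x + Pi.single k 1 ∨ s = x := by
  rw [mem_tbonds_iff] at h
  rcases h with h | h | h | h <;> simp only [Prod.mk.injEq] at h
  · exact absurd h.2.symm hkl
  · exact Or.inl h.1
  · exact absurd h.2.symm hkl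
  · exact Or.inr h.1

/-! ## §3. Two distinct genuine plaquettes share at most one bond -/

/-- Two `k`-bonds `(s₁,k) ≠ (s₂,k)` of `(x,k,l)` have base points `{x, x+e_l}` in some order. [folklore] -/
theorem sites_of_two_fst {x : Site d L} {k l : Fin d} (hkl : k ≠ l) {s₁ s₂ : Site d L}
    (hs : s₁ ≠ s₂) (h1 : ((s₁, k) : Edge d L) ∈ TPlaq.tbonds ((x, k, l) : TPlaq d L))
    (h2 : ((s₂, k) : Edge d L) ∈ TPlaq.tbonds ((x, k, l) : TPlaq d L)) :
    (s₁ = x ∧ s₂ = x + Pi.single l 1) ∨ (s₁ = x + Pi.single l 1 ∧ s₂ = x) := by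
  rcases site_of_mem_tbonds_fst hkl h1 with rfl | rfl <;>
    rcases site_of_mem_tbonds_fst hkl h2 with h | h
  · exact absurd h.symm hs
  · exact Or.inl ⟨rfl, h⟩
  · exact Or.inr ⟨rfl, h⟩
  · exact absurd h.symm hs

/-- Two `l`-bonds `(s₁,l) ≠ (s₂,l)` of `(x,k,l)` have base points `{x+e_k, x}` in some order. [folklore] -/
theorem sites_of_two_snd {x : Site d L} {k l : Fin d} (hkl : k ≠ l) {s₁ s₂ : Site d L}
    (hs : s₁ ≠ s₂) (h1 : ((s₁, l) : Edge d L) ∈ TPlaq.tbonds ((x, k, l) : TPlaq d L))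
    (h2 : ((s₂, l) : Edge d L) ∈ TPlaq.tbonds ((x, k, l) : TPlaq d L)) :
    (s₁ = x + Pi.single k 1 ∧ s₂ = x) ∨ (s₁ = x ∧ s₂ = x + Pi.single k 1) := by
  rcases site_of_mem_tbonds_snd hkl h1 with rfl | rfl <;>
    rcases site_of_mem_tbonds_snd hkl h2 with h | h
  · exact absurd h.symm hs
  · exact Or.inl ⟨rfl, h⟩
  · exact Or.inr ⟨rfl, h⟩
  · exact absurd h.symm hs

/-- The set equation `{x, x + e} = {y, y + e'}` (as ordered pairs in either order) on a torus of
side `≥ 3` forces `x = y` and `e = e'`. [folklore] -/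
theorem base_eq_of_pairs (hL : 3 ≤ L) {x y : Site d L} {n n' : Fin d} {s₁ s₂ : Site d L}
    (hq : (s₁ = x ∧ s₂ = x + Pi.single n 1) ∨ (s₁ = x + Pi.single n 1 ∧ s₂ = x))
    (hr : (s₁ = y ∧ s₂ = y + Pi.single n' 1) ∨ (s₁ = y + Pi.single n' 1 ∧ s₂ = y)) :
    x = y ∧ n = n' := by
  rcases hq with ⟨hq1, hq2⟩ | ⟨hq1, hq2⟩ <;> rcases hr with ⟨hr1, hr2⟩ | ⟨hr1, hr2⟩
  · have hxy : x = y := hq1.symm.trans hr1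
    subst hxy
    exact ⟨rfl, eq_of_add_single_eq (by omega) (hq2.symm.trans hr2)⟩
  · exfalso
    have hxy : x = y + Pi.single n' 1 := hq1.symm.trans hr1
    have h2 : x + Pi.single n 1 = y := hq2.symm.trans hr2
    rw [hxy] at h2
    exact add_single_add_single_ne_self hL y n' n h2
  · exfalso
    have hxy : x = y + Pi.single n' 1 := hq2.symm.trans hr2
    have h2 : x + Pi.single n 1 = y := hq1.symm.trans hr1
    rw [hxy] at h2
    exact add_single_add_single_ne_self hL y n' n h2
  · have hxy : x = y := hq2.symm.trans hr2
    subst hxy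
    exact ⟨rfl, eq_of_add_single_eq (by omega) (hq1.symm.trans hr1)⟩

/-- **Two distinct genuine plaquette labels of the torus of side `L ≥ 3` share at most one bond**:
if two different bonds lie in both bond sets, the labels coincide. [folklore] -/
theorem eq_of_two_mem_tbonds (hL : 3 ≤ L) {q r : TPlaq d L} (hq : q.2.1 < q.2.2)
    (hr : r.2.1 < r.2.2) {b₁ b₂ : Edge d L} (hb : b₁ ≠ b₂) (h1q : b₁ ∈ q.tbonds)
    (h1r : b₁ ∈ r.tbonds) (h2q : b₂ ∈ q.tbonds) (h2r : b₂ ∈ r.tbonds) : q = r := by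
  obtain ⟨x, k, l⟩ := q
  obtain ⟨y, k', l'⟩ := r
  obtain ⟨s₁, m₁⟩ := b₁
  obtain ⟨s₂, m₂⟩ := b₂
  simp only at hq hr
  have hkl : k ≠ l := Fin.ne_of_lt hq
  have hkl' : k' ≠ l' := Fin.ne_of_lt hr
  have hL2 : 2 ≤ L := by omega
  have hm1 := dir_of_mem_tbonds h1q
  have hm1' := dir_of_mem_tbonds h1r
  have hm2 := dir_of_mem_tbonds h2q
  have hm2' := dir_of_mem_tbonds h2r
  by_cases hmm : m₁ = m₂
  · -- (I) two parallel shared bonds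
    subst hmm
    have hs : s₁ ≠ s₂ := fun h => hb (by rw [h])
    rcases hm1 with rfl | rfl
    · -- the shared bonds are the two `k`-bonds of `q`
      have hqq := sites_of_two_fst hkl hs h1q h2q
      rcases hm1' with h | h
      · subst h
        have hrr := sites_of_two_fst hkl' hs h1r h2r
        obtain ⟨rfl, hll⟩ := base_eq_of_pairs hL hqq hrr
        subst hll; rfl
      · subst h
        have hrr := sites_of_two_snd hkl' hs h1r h2r
        have hrr' : (s₁ = y ∧ s₂ = y + Pi.single k' 1) ∨ (s₁ = y + Pi.single k' 1 ∧ s₂ = y) :=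
          hrr.symm
        obtain ⟨rfl, hlk⟩ := base_eq_of_pairs hL hqq hrr'
        subst hlk
        exfalso; exact lt_asymm hq hr
    · -- the shared bonds are the two `l`-bonds of `q`
      have hqq := sites_of_two_snd hkl hs h1q h2q
      have hqq' : (s₁ = x ∧ s₂ = x + Pi.single k 1) ∨ (s₁ = x + Pi.single k 1 ∧ s₂ = x) :=
        hqq.symm
      rcases hm1' with h | h
      · subst h
        have hrr := sites_of_two_fst hkl' hs h1r h2r
        obtain ⟨rfl, hkl2⟩ := base_eq_of_pairs hL hqq' hrr
        subst hkl2
        exfalso; exact lt_asymm hq hr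
      · subst h
        have hrr := sites_of_two_snd hkl' hs h1r h2r
        have hrr' : (s₁ = y ∧ s₂ = y + Pi.single k' 1) ∨ (s₁ = y + Pi.single k' 1 ∧ s₂ = y) :=
          hrr.symm
        obtain ⟨rfl, hkk⟩ := base_eq_of_pairs hL hqq' hrr'
        subst hkk; rfl
  · -- (II) two orthogonal shared bonds: the planes agree
    have hdir : k = k' ∧ l = l' := by
      rcases hm1 with rfl | rfl <;> rcases hm2 with h | h
      · exact absurd h.symm hmm
      · subst h
        rcases hm1' with h1 | h1 <;> rcases hm2' with h2 | h2
        · exact absurd (h1.trans h2.symm) hmm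
        · exact ⟨h1, h2⟩
        · exfalso; subst h1; subst h2; exact lt_asymm hq hr
        · exact absurd (h1.trans h2.symm) hmm
      · subst h
        rcases hm1' with h1 | h1 <;> rcases hm2' with h2 | h2
        · exact absurd (h1.trans h2.symm) hmm
        · exfalso; subst h1; subst h2; exact lt_asymm hq hr
        · exact ⟨h2, h1⟩
        · exact absurd (h1.trans h2.symm) hmm
      · exact absurd h.symm hmm
    obtain ⟨rfl, rfl⟩ := hdir
    -- one shared `k`-bond and one shared `l`-bond force `x = y`
    suffices hxy : x = y by subst hxy; rfl
    -- extract a shared `k`-bond `(t, k)` and a shared `l`-bond `(t', l)`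
    have key : ∀ {t t' : Site d L}, ((t, k) : Edge d L) ∈ TPlaq.tbonds ((x, k, l) : TPlaq d L) →
        ((t, k) : Edge d L) ∈ TPlaq.tbonds ((y, k, l) : TPlaq d L) →
        ((t', l) : Edge d L) ∈ TPlaq.tbonds ((x, k, l) : TPlaq d L) →
        ((t', l) : Edge d L) ∈ TPlaq.tbonds ((y, k, l) : TPlaq d L) → x = y := by
      intro t t' htq htr ht'q ht'r
      have a1 := site_of_mem_tbonds_fst hkl htq
      have a2 := site_of_mem_tbonds_fst hkl htr
      have b1 := site_of_mem_tbonds_snd hkl ht'q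
      have b2 := site_of_mem_tbonds_snd hkl ht'r
      have HA : x = y ∨ x = y + Pi.single l 1 ∨ x + Pi.single l 1 = y := by
        rcases a1 with h | h <;> rcases a2 with h' | h'
        · exact Or.inl (h.symm.trans h')
        · exact Or.inr (Or.inl (h.symm.trans h'))
        · exact Or.inr (Or.inr (h.symm.trans h'))
        · exact Or.inl (add_right_cancel (h.symm.trans h'))
      have HB : x = y ∨ x + Pi.single k 1 = y ∨ x = y + Pi.single k 1 := by
        rcases b1 with h | h <;> rcases b2 with h' | h'
        · exact Or.inl (add_right_cancel (h.symm.trans h'))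
        · exact Or.inr (Or.inl (h.symm.trans h'))
        · exact Or.inr (Or.inr (h.symm.trans h'))
        · exact Or.inl (h.symm.trans h')
      rcases HA with h | h | h
      · exact h
      · rcases HB with h' | h' | h'
        · exact h'
        · exfalso
          rw [h] at h'
          exact add_single_add_single_ne_self hL y l k h'
        · exfalso
          exact hkl (eq_of_add_single_eq hL2 (h.symm.trans h')).symm
      · rcases HB with h' | h' | h'
        · exact h'
        · exfalso
          exact hkl (eq_of_add_single_eq hL2 (h.trans h'.symm)).symm
        · exfalso
          rw [h'] at h
          exact add_single_add_single_ne_self hL y k l h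
    rcases hm1 with rfl | rfl
    · rcases hm2 with h | rfl
      · exact absurd h.symm hmm
      · exact key h1q h1r h2q h2r
    · rcases hm2 with rfl | h
      · exact key h2q h2r h1q h1r
      · exact absurd h.symm hmm

/-- **A genuine label other than `q` contains at most one bond of `q`**: given a bond `b₀` of `q`
lying in `r ≠ q`, every other bond of `q` is outside `r`. [folklore] -/
theorem not_mem_of_mem_of_ne (hL : 3 ≤ L) {q r : TPlaq d L} (hq : q.2.1 < q.2.2)
    (hr : r.2.1 < r.2.2) (hqr : q ≠ r) {b₀ b : Edge d L} (hb : b ≠ b₀) (h0q : b₀ ∈ q.tbonds)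
    (h0r : b₀ ∈ r.tbonds) (hbq : b ∈ q.tbonds) : b ∉ r.tbonds :=
  fun hbr => hqr (eq_of_two_mem_tbonds hL hq hr hb hbq hbr h0q h0r)

/-- The intersection of the bond sets of two distinct genuine labels has at most one element. [folklore] -/
theorem card_inter_tbonds_le_one (hL : 3 ≤ L) {q r : TPlaq d L} (hq : q.2.1 < q.2.2)
    (hr : r.2.1 < r.2.2) (hqr : q ≠ r) : (q.tbonds ∩ r.tbonds).card ≤ 1 := by
  rw [Finset.card_le_one]
  intro b₁ h1 b₂ h2
  rw [Finset.mem_inter] at h1 h2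
  by_contra hb
  exact hqr (eq_of_two_mem_tbonds hL hq hr hb h1.1 h1.2 h2.1 h2.2)

/-! ## §4. The four bonds of a genuine label are distinct -/

/-- The four bonds of a genuine label `(x,k,l)`, `k ≠ l`, `L ≥ 2`, are pairwise distinct. [folklore] -/
theorem tbonds_pairwise_ne (hL : 2 ≤ L) {x : Site d L} {k l : Fin d} (hkl : k ≠ l) :
    ((x, k) : Edge d L) ≠ (x + Pi.single k 1, l) ∧ ((x, k) : Edge d L) ≠ (x + Pi.single l 1, k) ∧
      ((x, k) : Edge d L) ≠ (x, l) ∧ ((x + Pi.single k 1, l) : Edge d L) ≠ (x + Pi.single l 1, k) ∧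
      ((x + Pi.single k 1, l) : Edge d L) ≠ (x, l) ∧ ((x + Pi.single l 1, k) : Edge d L) ≠ (x, l) := by
  refine ⟨?_, ?_, ?_, ?_, ?_, ?_⟩ <;> intro h <;> simp only [Prod.mk.injEq] at h
  · exact hkl h.2
  · exact add_single_ne_self hL x l h.1.symm
  · exact hkl h.2
  · exact hkl h.2.symm
  · exact add_single_ne_self hL x k h.1
  · exact hkl h.2

/-- The bond set of a genuine label has exactly four elements. [folklore] -/
theorem card_tbonds (hL : 2 ≤ L) {q : TPlaq d L} (hq : q.2.1 < q.2.2) : q.tbonds.card = 4 := by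
  obtain ⟨x, k, l⟩ := q
  have h := tbonds_pairwise_ne hL (x := x) (Fin.ne_of_lt hq)
  simp only [TPlaq.tbonds, Site.shift]
  rw [Finset.card_insert_of_notMem, Finset.card_insert_of_notMem, Finset.card_insert_of_notMem,
    Finset.card_singleton]
  · simp only [Finset.mem_singleton]; exact h.2.2.2.2.2
  · simp only [Finset.mem_insert, Finset.mem_singleton, not_or]; exact ⟨h.2.2.2.1, h.2.2.2.2.1⟩
  · simp only [Finset.mem_insert, Finset.mem_singleton, not_or]; exact ⟨h.1, h.2.1, h.2.2.1⟩

/-- **A genuine label `q ≠ r` has a bond outside `r` and different from any TWO prescribed bonds of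
`q` lying in other labels**: concretely, if at most one bond of `q` lies in each of `r₁, …` — used
in the form: given bonds `c₁, c₂` (the possible contacts with two fixed plaquettes), `q` has a bond
`∉ r.tbonds` other than `c₁, c₂` as soon as `r ≠ q` meets `q` in at most one bond.  Minimal form
proved here: `q` has at least two bonds outside `r`. [folklore] -/
theorem two_le_card_tbonds_sdiff (hL : 3 ≤ L) {q r : TPlaq d L} (hq : q.2.1 < q.2.2)
    (hr : r.2.1 < r.2.2) (hqr : q ≠ r) : 3 ≤ (q.tbonds \ r.tbonds).card := by
  have h1 := card_inter_tbonds_le_one hL hq hr hqr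
  have h2 := card_tbonds (by omega : 2 ≤ L) hq
  have h3 := Finset.card_sdiff_add_card_inter q.tbonds r.tbonds
  omega

end Summit.Ventures.LatticeQCDFlow.Theory2.Lattice.TorusGeom
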